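import Summits.CriticalPhenomena.PercolationContinuityZ3.Theorems.PercNearOneGluingNoHeavyLowerTailFrontierDecRowsRow44CutVertex
import Summits.CriticalPhenomena.PercolationContinuityZ3.Theorems.PercNearOneGluingNoHeavyLowerTailFrontierDecRowsRow44CrossCutSide
import Mathlib.Tactic.Linarith
import HarnessLib

/-!
# Row 36 across an `{a,y} | {b,c}` cut vertex (route `PercNearOneGluingNoHeavy`, supports-only; prim-l12-p6 g15)

Frontier dec row 36 is `E₃(D[a|b], D[a|c], D[b|y]) ≥ 0` (the path `c – a – b – y`).  Here a cut vertex `h` separates `{a,y}` (colour `true`) from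
`{b,c}` (colour `false`): all three separations cross the cut.  With `…Row36CutVertex` (`{a,c} | {b,y}`), `…Row36CutVertexAB` (`{a,b} | {c,y}`)
and `…Row36ThreeOneCutA/C/All` this covers EVERY cut vertex separating the terminals of row 36 (memo §8.4).

THEOREM (`sahiE3_row36_nonneg_of_cutVertexAY`).  Unconditionally `0 ≤ E₃(row 36 at (a,b,c,y))` on such a graph.
PROOF.  Near side: `p_a = P(a↔h)`, `p_y = P(y↔h)`, `p_ay = P(a↔h↔y)`; far side: `k_b = P(h↔b)`, `k_c = P(h↔c)`, `k_bc = P(b↔h↔c)`.  With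
`A = p_a k_b, B = p_a k_c, C = p_y k_b, U = p_a k_bc, V = p_ay k_b, W = p_ay k_bc` one has `E₃ = U + V − W − AB − AC − BC − ABC + AW + BV + CU`, and
  **`E₃ = (k_bc − k_b k_c)·[(p_a − p_ay) + k_b p_a (p_ay + p_y)] + k_b·[(1−k_c)·((p_ay − p_a p_y) + (1−k_b) p_a p_y) + k_c·((p_ay − p_a p_y) + (1−p_a)(p_a − p_ay) + k_b p_a (p_ay − p_a p_y))]`**,
every bracket non-negative by Harris on the two sides and the cell inequalities.  ∎
Recorded in `run/shared/lean/prim/prim-l12/FROM-prim-l12-p6-g15-ROW44-CUT-VERTICES.md` §8.4.  No definitions, no named facts, no sorries.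
-/

noncomputable section

namespace Summit.CriticalPhenomena.PercolationContinuityZ3.Theorems.FrontierDecRows

open MeasureTheory CovTransferCert E3GroupSepCert
open Literature.Probability.Percolation Literature.Probability.LatticeModels

variable {n : ℕ}

/-- The `{a,y} | {b,c}` certificate for row 36 in real variables (see the file header). [this work] -/
theorem row36_cutVertexAY_ineq (pa py pay kb kc kbc : ℝ) (hpa0 : 0 ≤ pa) (hpa1 : pa ≤ 1) (hpy0 : 0 ≤ py) (hpay0 : 0 ≤ pay)
    (hpaya : pay ≤ pa) (hH1 : pa * py ≤ pay) (hkb0 : 0 ≤ kb) (hkb1 : kb ≤ 1) (hkc0 : 0 ≤ kc) (hkc1 : kc ≤ 1) (hH2 : kb * kc ≤ kbc) :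
    0 ≤ 2 * (1 - pa * kb - pa * kc - py * kb + pa * kbc + pay * kb + pay * kbc - pay * kbc) +
      (1 - pa * kb) * (1 - pa * kc) * (1 - py * kb) -
      ((1 - pa * kb) * (1 - pa * kc - py * kb + pay * kbc) + (1 - pa * kc) * (1 - pa * kb - py * kb + pay * kb) +
        (1 - py * kb) * (1 - pa * kb - pa * kc + pa * kbc)) := by
  have key : 2 * (1 - pa * kb - pa * kc - py * kb + pa * kbc + pay * kb + pay * kbc - pay * kbc) +
      (1 - pa * kb) * (1 - pa * kc) * (1 - py * kb) -
      ((1 - pa * kb) * (1 - pa * kc - py * kb + pay * kbc) + (1 - pa * kc) * (1 - pa * kb - py * kb + pay * kb) +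
        (1 - py * kb) * (1 - pa * kb - pa * kc + pa * kbc)) =
      (kbc - kb * kc) * ((pa - pay) + kb * pa * (pay + py)) +
      kb * ((1 - kc) * ((pay - pa * py) + (1 - kb) * pa * py) + kc * ((pay - pa * py) + (1 - pa) * (pa - pay) + kb * pa * (pay - pa * py))) := by
    ring
  rw [key]
  have h1 : 0 ≤ pay - pa * py := sub_nonneg.2 hH1
  have h2 : 0 ≤ pa - pay := sub_nonneg.2 hpaya
  have hpapy : 0 ≤ pa * py := mul_nonneg hpa0 hpy0
  refine add_nonneg (mul_nonneg (sub_nonneg.2 hH2) (add_nonneg h2 (mul_nonneg (mul_nonneg hkb0 hpa0) (add_nonneg hpay0 hpy0)))) ?_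
  refine mul_nonneg hkb0 (add_nonneg ?_ ?_)
  · exact mul_nonneg (sub_nonneg.2 hkc1) (add_nonneg h1 (mul_nonneg (mul_nonneg (sub_nonneg.2 hkb1) hpa0) hpy0))
  · exact mul_nonneg hkc0 (add_nonneg (add_nonneg h1 (mul_nonneg (sub_nonneg.2 hpa1) h2)) (mul_nonneg (mul_nonneg hkb0 hpa0) h1))

set_option maxHeartbeats 1600000 in
/-- **Row 36 across an `{a,y} | {b,c}` cut vertex** (every one of the three separations `a|b`, `a|c`, `b|y` crosses the cut).  If every
positive-weight edge avoiding `h` is monochromatic, `a, y` coloured `true` and `b, c` coloured `false`, then `0 ≤ E₃(D[a|b], D[a|c], D[b|y])` at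
`(a,b,c,y)` — Harris on each side (`P(a↔h↔y) ≥ P(a↔h)P(y↔h)`, `P(b↔h↔c) ≥ P(h↔b)P(h↔c)`) and an explicit nonnegative certificate. [this work] -/
theorem sahiE3_row36_nonneg_of_cutVertexAY (w : Sym2 (Fin n) → unitInterval) (a b c y h : Fin n) (side : Fin n → Bool)
    (ha : side a = true) (hy : side y = true) (hb : side b = false) (hc : side c = false)
    (hw : ∀ u v : Fin n, u ≠ h → v ≠ h → side u ≠ side v → w s(u, v) = 0) :
    0 ≤ sahiE3 (prodBernoulli w) (connEvent (row 36 n (a, b, c, y)).1) (connEvent (row 36 n (a, b, c, y)).2.1)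
      (connEvent (row 36 n (a, b, c, y)).2.2) := by
  classical
  have hrow : row 36 n (a, b, c, y) = (sep [a] [b], sep [a] [c], sep [b] [y]) := rfl
  simp only [hrow, connEvent_sep]
  set μ := prodBernoulli w with hμ
  set X : Set (Set (Sym2 (Fin n))) := {ω | ∀ x ∈ [a], ∀ z ∈ [b], ω ∉ openConn x z} with hX
  set Y : Set (Set (Sym2 (Fin n))) := {ω | ∀ x ∈ [a], ∀ z ∈ [c], ω ∉ openConn x z} with hY
  set Z : Set (Set (Sym2 (Fin n))) := {ω | ∀ x ∈ [b], ∀ z ∈ [y], ω ∉ openConn x z} with hZ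
  have hab : a ≠ b := fun e => by rw [e, hb] at ha; exact Bool.false_ne_true ha
  have hac : a ≠ c := fun e => by rw [e, hc] at ha; exact Bool.false_ne_true ha
  have hyb : y ≠ b := fun e => by rw [e, hb] at hy; exact Bool.false_ne_true hy
  set F₁ : Finset (Sym2 (Fin n)) := Finset.univ.filter (fun e => ∀ u ∈ e, side u = true ∨ u = h) with hF₁
  set F₂ : Finset (Sym2 (Fin n)) :=
    Finset.univ.filter (fun e => (∀ u ∈ e, side u = false ∨ u = h) ∧ ¬ ∀ u ∈ e, u = h) with hF₂
  have mem₁ : ∀ e, e ∈ F₁ ↔ ∀ u ∈ e, side u = true ∨ u = h := fun e => by rw [hF₁, Finset.mem_filter]; simp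
  have mem₂ : ∀ e, e ∈ F₂ ↔ (∀ u ∈ e, side u = false ∨ u = h) ∧ ¬ ∀ u ∈ e, u = h := fun e => by
    rw [hF₂, Finset.mem_filter]; simp
  have hdisj : Disjoint F₁ F₂ := by
    rw [Finset.disjoint_left]
    intro e h1 h2
    rw [mem₁] at h1; rw [mem₂] at h2
    apply h2.2
    intro u hu
    rcases h1 u hu with h1 | h1
    · rcases h2.1 u hu with h2 | h2
      · rw [h1] at h2; exact absurd h2 (by decide)
      · exact h2
    · exact h1
  set D : Finset (Sym2 (Fin n)) := F₁ ∪ F₂ with hD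
  have hwD : ∀ e, e ∉ D → w e = 0 := by
    intro e he
    rw [hD, Finset.mem_union, not_or, mem₁, mem₂] at he
    obtain ⟨h1, h2⟩ := he
    induction e using Sym2.ind with
    | h u v =>
      have key : u ≠ h ∧ v ≠ h ∧ side u ≠ side v := by
        by_cases hu : u = h
        · subst hu
          exfalso
          by_cases hv : v = u
          · exact h1 fun x hx => Or.inr (by rcases Sym2.mem_iff.1 hx with e | e <;> [exact e; exact e.trans hv])
          · cases hsv : side v
            · exact h2 ⟨fun x hx => by rcases Sym2.mem_iff.1 hx with e | e <;> [exact Or.inr e; exact Or.inl (e ▸ hsv)],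
                fun hall => hv (hall v (Sym2.mem_iff.2 (Or.inr rfl)))⟩
            · exact h1 fun x hx => by rcases Sym2.mem_iff.1 hx with e | e <;> [exact Or.inr e; exact Or.inl (e ▸ hsv)]
        · by_cases hv : v = h
          · subst hv
            exfalso
            cases hsu : side u
            · exact h2 ⟨fun x hx => by rcases Sym2.mem_iff.1 hx with e | e <;> [exact Or.inl (e ▸ hsu); exact Or.inr e],
                fun hall => hu (hall u (Sym2.mem_iff.2 (Or.inl rfl)))⟩
            · exact h1 fun x hx => by rcases Sym2.mem_iff.1 hx with e | e <;> [exact Or.inl (e ▸ hsu); exact Or.inr e]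
          · refine ⟨hu, hv, fun hse => ?_⟩
            cases hsu : side u
            · exact h2 ⟨fun x hx => by
                  rcases Sym2.mem_iff.1 hx with e | e <;> [exact Or.inl (e ▸ hsu); exact Or.inl (e ▸ (hse ▸ hsu))],
                fun hall => hu (hall u (Sym2.mem_iff.2 (Or.inl rfl)))⟩
            · exact h1 fun x hx => by
                rcases Sym2.mem_iff.1 hx with e | e <;> [exact Or.inl (e ▸ hsu); exact Or.inl (e ▸ (hse ▸ hsu))]
      exact hw u v key.1 key.2.1 key.2.2
  have hT : ∀ ω : Set (Sym2 (Fin n)), ∀ v u u', (openGraph (ω ∩ ↑F₁)).Adj v u → (openGraph (ω ∩ ↑F₂)).Adj v u' → v = h := by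
    intro ω v u u' h1 h2
    rw [openGraph_adj] at h1 h2
    have e1 := (mem₁ _).1 (Finset.mem_coe.1 h1.1.2) v (Sym2.mem_iff.2 (Or.inl rfl))
    have e2 := ((mem₂ _).1 (Finset.mem_coe.1 h2.1.2)).1 v (Sym2.mem_iff.2 (Or.inl rfl))
    rcases e1 with e1 | e1
    · rcases e2 with e2 | e2
      · rw [e1] at e2; exact absurd e2 (by decide)
      · exact e2
    · exact e1
  have iso₂ : ∀ ω : Set (Sym2 (Fin n)), ∀ x, side x = true → x ≠ h → ∀ u, ¬ (openGraph (ω ∩ ↑F₂)).Adj x u := by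
    intro ω x hx hxh u hadj
    rw [openGraph_adj] at hadj
    rcases ((mem₂ _).1 (Finset.mem_coe.1 hadj.1.2)).1 x (Sym2.mem_iff.2 (Or.inl rfl)) with e | e
    · rw [hx] at e; exact Bool.noConfusion e
    · exact hxh e
  have iso₁ : ∀ ω : Set (Sym2 (Fin n)), ∀ x, side x = false → x ≠ h → ∀ u, ¬ (openGraph (ω ∩ ↑F₁)).Adj x u := by
    intro ω x hx hxh u hadj
    rw [openGraph_adj] at hadj
    rcases (mem₁ _).1 (Finset.mem_coe.1 hadj.1.2) x (Sym2.mem_iff.2 (Or.inl rfl)) with e | e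
    · rw [hx] at e; exact Bool.noConfusion e
    · exact hxh e
  have hsup : ∀ ω : Set (Sym2 (Fin n)), openGraph (ω ∩ ↑D) = openGraph (ω ∩ ↑F₁) ⊔ openGraph (ω ∩ ↑F₂) := by
    intro ω
    rw [hD, Finset.coe_union, Set.inter_union_distrib_left]
    exact SimpleGraph.fromEdgeSet_union _ _
  have pc : ∀ ω : Set (Sym2 (Fin n)), ∀ x z, side x = true → side z = false → x ≠ z →
      ((openGraph (ω ∩ ↑D)).Reachable x z ↔
        (openGraph (ω ∩ ↑F₁)).Reachable x h ∧ (openGraph (ω ∩ ↑F₂)).Reachable h z) := by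
    intro ω x z hx hz hxz; rw [hsup ω]; exact reachable_sup_iff_cross (hT ω) (iso₂ ω x hx) (iso₁ ω z hz) hxz
  set Ha : Set (Set (Sym2 (Fin n))) := {ω | ω ∩ ↑F₁ ∈ (openConn a h : Set (Set (Sym2 (Fin n))))} with hHa
  set Hy : Set (Set (Sym2 (Fin n))) := {ω | ω ∩ ↑F₁ ∈ (openConn y h : Set (Set (Sym2 (Fin n))))} with hHy
  set K₁ : Set (Set (Sym2 (Fin n))) := {ω | ω ∩ ↑F₁ ∈ (openConn a y : Set (Set (Sym2 (Fin n))))} with hK₁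
  set Kb : Set (Set (Sym2 (Fin n))) := {ω | ω ∩ ↑F₂ ∈ (openConn h b : Set (Set (Sym2 (Fin n))))} with hKb
  set Kc : Set (Set (Sym2 (Fin n))) := {ω | ω ∩ ↑F₂ ∈ (openConn h c : Set (Set (Sym2 (Fin n))))} with hKc
  set K₂ : Set (Set (Sym2 (Fin n))) := {ω | ω ∩ ↑F₂ ∈ (openConn b c : Set (Set (Sym2 (Fin n))))} with hK₂
  have tX : {ω : Set (Sym2 (Fin n)) | ω ∩ ↑D ∈ X} = (Ha ∩ Kb)ᶜ := by
    ext ω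
    simp only [hX, hHa, hKb, Set.mem_setOf_eq, List.mem_singleton, forall_eq, Set.mem_compl_iff, Set.mem_inter_iff, openConn]
    rw [pc ω a b ha hb hab]
  have tY : {ω : Set (Sym2 (Fin n)) | ω ∩ ↑D ∈ Y} = (Ha ∩ Kc)ᶜ := by
    ext ω
    simp only [hY, hHa, hKc, Set.mem_setOf_eq, List.mem_singleton, forall_eq, Set.mem_compl_iff, Set.mem_inter_iff, openConn]
    rw [pc ω a c ha hc hac]
  have tZ : {ω : Set (Sym2 (Fin n)) | ω ∩ ↑D ∈ Z} = (Hy ∩ Kb)ᶜ := by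
    ext ω
    simp only [hZ, hHy, hKb, Set.mem_setOf_eq, List.mem_singleton, forall_eq, Set.mem_compl_iff, Set.mem_inter_iff, openConn]
    rw [SimpleGraph.reachable_comm (u := b) (v := y), pc ω y b hy hb hyb]
  have thin : ∀ X : Set (Set (Sym2 (Fin n))), μ.real X = μ.real {ω | ω ∩ ↑D ∈ X} :=
    fun X => real_eq_real_setOf_inter_mem w D hwD X
  have pre_inter : ∀ P Q : Set (Set (Sym2 (Fin n))),
      {ω : Set (Sym2 (Fin n)) | ω ∩ ↑D ∈ P ∩ Q} = {ω | ω ∩ ↑D ∈ P} ∩ {ω | ω ∩ ↑D ∈ Q} := fun P Q => rfl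
  have ms : ∀ X : Set (Set (Sym2 (Fin n))), MeasurableSet X := fun X => (Set.toFinite _).measurableSet
  -- independence of the sides
  have indep : ∀ P Q : Set (Set (Sym2 (Fin n))),
      μ.real ({ω | ω ∩ ↑F₁ ∈ P} ∩ {ω | ω ∩ ↑F₂ ∈ Q}) = μ.real {ω | ω ∩ ↑F₁ ∈ P} * μ.real {ω | ω ∩ ↑F₂ ∈ Q} := by
    intro P Q
    refine prodBernoulli_real_inter_of_determinedBy w F₁ ?_ ?_ (ms _) (ms _)
    · rw [determinedBy_iff]; intro ω ω' hω; simp only [Set.mem_setOf_eq, hω]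
    · rw [determinedBy_iff]
      intro ω ω' hω
      have hsub : (↑F₂ : Set (Sym2 (Fin n))) ⊆ (↑F₁ : Set (Sym2 (Fin n)))ᶜ := fun e he he1 =>
        Finset.disjoint_left.1 hdisj (Finset.mem_coe.1 he1) (Finset.mem_coe.1 he)
      have : ω ∩ ↑F₂ = ω' ∩ ↑F₂ := by
        rw [← Set.inter_eq_self_of_subset_right hsub, ← Set.inter_assoc, ← Set.inter_assoc, hω]
      simp only [Set.mem_setOf_eq, this]
  have cpl : ∀ S : Set (Set (Sym2 (Fin n))), μ.real Sᶜ = 1 - μ.real S := by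
    intro S; rw [Set.compl_eq_univ_sdiff, measureReal_sdiff (Set.subset_univ _) (ms _)]; simp [hμ]
  have cc2 : ∀ P Q : Set (Set (Sym2 (Fin n))), μ.real (Pᶜ ∩ Qᶜ) = 1 - μ.real P - μ.real Q + μ.real (P ∩ Q) := by
    intro P Q
    rw [← Set.compl_union, cpl]
    have h1 := measureReal_union_add_inter (μ := μ) (s := P) (ms Q)
    linarith
  have cc3 : ∀ P Q R : Set (Set (Sym2 (Fin n))), μ.real (Pᶜ ∩ Qᶜ ∩ Rᶜ) =
      1 - μ.real P - μ.real Q - μ.real R + μ.real (P ∩ Q) + μ.real (P ∩ R) + μ.real (Q ∩ R) - μ.real (P ∩ Q ∩ R) := by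
    intro P Q R
    have e : Pᶜ ∩ Qᶜ ∩ Rᶜ = ((P ∪ Q) ∪ R)ᶜ := by
      ext ω; simp only [Set.mem_inter_iff, Set.mem_compl_iff, Set.mem_union]; tauto
    rw [e, cpl]
    have h1 := measureReal_union_add_inter (μ := μ) (s := P ∪ Q) (ms R)
    have h2 := measureReal_union_add_inter (μ := μ) (s := P) (ms Q)
    have h3 := measureReal_union_add_inter (μ := μ) (s := P ∩ R) (ms (Q ∩ R))
    have e2 : (P ∪ Q) ∩ R = (P ∩ R) ∪ (Q ∩ R) := Set.union_inter_distrib_right P Q R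
    have e3 : (P ∩ R) ∩ (Q ∩ R) = P ∩ Q ∩ R := by
      ext ω; simp only [Set.mem_inter_iff]; tauto
    rw [e2] at h1
    rw [e3] at h3
    linarith
  -- independence instances and regroupings
  have iAB : μ.real (Ha ∩ Kb) = μ.real Ha * μ.real Kb := indep (openConn a h) (openConn h b)
  have iAC : μ.real (Ha ∩ Kc) = μ.real Ha * μ.real Kc := indep (openConn a h) (openConn h c)
  have iYB : μ.real (Hy ∩ Kb) = μ.real Hy * μ.real Kb := indep (openConn y h) (openConn h b)
  have iU : μ.real (Ha ∩ (Kb ∩ Kc)) = μ.real Ha * μ.real (Kb ∩ Kc) := indep (openConn a h) (openConn h b ∩ openConn h c)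
  have iV : μ.real ((Ha ∩ Hy) ∩ Kb) = μ.real (Ha ∩ Hy) * μ.real Kb := indep (openConn a h ∩ openConn y h) (openConn h b)
  have iW : μ.real ((Ha ∩ Hy) ∩ (Kb ∩ Kc)) = μ.real (Ha ∩ Hy) * μ.real (Kb ∩ Kc) :=
    indep (openConn a h ∩ openConn y h) (openConn h b ∩ openConn h c)
  have r1 : (Ha ∩ Kb) ∩ (Ha ∩ Kc) = Ha ∩ (Kb ∩ Kc) := by ext ω; simp only [Set.mem_inter_iff]; tauto
  have r2 : (Ha ∩ Kb) ∩ (Hy ∩ Kb) = (Ha ∩ Hy) ∩ Kb := by ext ω; simp only [Set.mem_inter_iff]; tauto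
  have r3 : (Ha ∩ Kc) ∩ (Hy ∩ Kb) = (Ha ∩ Hy) ∩ (Kb ∩ Kc) := by ext ω; simp only [Set.mem_inter_iff]; tauto
  have r4 : (Ha ∩ Kb) ∩ (Ha ∩ Kc) ∩ (Hy ∩ Kb) = (Ha ∩ Hy) ∩ (Kb ∩ Kc) := by ext ω; simp only [Set.mem_inter_iff]; tauto
  -- the seven probabilities of the glued row
  have eX : μ.real X = 1 - μ.real Ha * μ.real Kb := by rw [thin, tX, cpl, iAB]
  have eY : μ.real Y = 1 - μ.real Ha * μ.real Kc := by rw [thin, tY, cpl, iAC]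
  have eZ : μ.real Z = 1 - μ.real Hy * μ.real Kb := by rw [thin, tZ, cpl, iYB]
  have eXY : μ.real (X ∩ Y) = 1 - μ.real Ha * μ.real Kb - μ.real Ha * μ.real Kc + μ.real Ha * μ.real (Kb ∩ Kc) := by
    rw [thin, pre_inter, tX, tY, cc2, r1, iAB, iAC, iU]
  have eXZ : μ.real (X ∩ Z) = 1 - μ.real Ha * μ.real Kb - μ.real Hy * μ.real Kb + μ.real (Ha ∩ Hy) * μ.real Kb := by
    rw [thin, pre_inter, tX, tZ, cc2, r2, iAB, iYB, iV]
  have eYZ : μ.real (Y ∩ Z) = 1 - μ.real Ha * μ.real Kc - μ.real Hy * μ.real Kb + μ.real (Ha ∩ Hy) * μ.real (Kb ∩ Kc) := by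
    rw [thin, pre_inter, tY, tZ, cc2, r3, iAC, iYB, iW]
  have eXYZ : μ.real (X ∩ Y ∩ Z) = 1 - μ.real Ha * μ.real Kb - μ.real Ha * μ.real Kc - μ.real Hy * μ.real Kb +
      μ.real Ha * μ.real (Kb ∩ Kc) + μ.real (Ha ∩ Hy) * μ.real Kb + μ.real (Ha ∩ Hy) * μ.real (Kb ∩ Kc) -
      μ.real (Ha ∩ Hy) * μ.real (Kb ∩ Kc) := by
    rw [thin, pre_inter, pre_inter, tX, tY, tZ, cc3, r4, r1, r2, r3, iAB, iAC, iYB, iU, iV, iW]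
  -- Harris and cells on the two sides
  have upPre₁ : ∀ u v : Fin n, IsUpperSet {ω : Set (Sym2 (Fin n)) | ω ∩ ↑F₁ ∈ (openConn u v : Set (Set (Sym2 (Fin n))))} :=
    fun u v ω ω' hle hω => isUpperSet_openConn u v (Set.inter_subset_inter_left _ hle) hω
  have upPre₂ : ∀ u v : Fin n, IsUpperSet {ω : Set (Sym2 (Fin n)) | ω ∩ ↑F₂ ∈ (openConn u v : Set (Set (Sym2 (Fin n))))} :=
    fun u v ω ω' hle hω => isUpperSet_openConn u v (Set.inter_subset_inter_left _ hle) hω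
  have trK₁ : Ha ∩ Hy ⊆ K₁ := fun ω hω => by
    simp only [hHa, hHy, hK₁, Set.mem_inter_iff, Set.mem_setOf_eq, openConn] at hω ⊢; exact hω.1.trans hω.2.symm
  have trG₁ : Ha ∩ K₁ ⊆ Hy := fun ω hω => by
    simp only [hHa, hHy, hK₁, Set.mem_inter_iff, Set.mem_setOf_eq, openConn] at hω ⊢; exact hω.2.symm.trans hω.1
  have trA₁ : Hy ∩ K₁ ⊆ Ha := fun ω hω => by
    simp only [hHa, hHy, hK₁, Set.mem_inter_iff, Set.mem_setOf_eq, openConn] at hω ⊢; exact hω.2.trans hω.1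
  have trK₂ : Kb ∩ Kc ⊆ K₂ := fun ω hω => by
    simp only [hKb, hKc, hK₂, Set.mem_inter_iff, Set.mem_setOf_eq, openConn] at hω ⊢; exact hω.1.symm.trans hω.2
  have trG₂ : Kb ∩ K₂ ⊆ Kc := fun ω hω => by
    simp only [hKb, hKc, hK₂, Set.mem_inter_iff, Set.mem_setOf_eq, openConn] at hω ⊢; exact hω.1.trans hω.2
  have trA₂ : Kc ∩ K₂ ⊆ Kb := fun ω hω => by
    simp only [hKb, hKc, hK₂, Set.mem_inter_iff, Set.mem_setOf_eq, openConn] at hω ⊢; exact hω.1.trans hω.2.symm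
  obtain ⟨⟨c4, -, c2, -, -⟩, ⟨-, -, g3⟩, -, -⟩ :=
    threePoint_side_facts w (upPre₁ a y) (upPre₁ a h) (upPre₁ y h) (ms _) (ms _) (ms _) trK₁ trG₁ trA₁
  obtain ⟨-, ⟨-, -, k3⟩, -, -⟩ :=
    threePoint_side_facts w (upPre₂ b c) (upPre₂ h b) (upPre₂ h c) (ms _) (ms _) (ms _) trK₂ trG₂ trA₂
  have hpa1 : μ.real Ha ≤ 1 := (measureReal_mono (Set.subset_univ Ha)).trans (le_of_eq (by simp [hμ]))
  have hkb1 : μ.real Kb ≤ 1 := (measureReal_mono (Set.subset_univ Kb)).trans (le_of_eq (by simp [hμ]))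
  have hkc1 : μ.real Kc ≤ 1 := (measureReal_mono (Set.subset_univ Kc)).trans (le_of_eq (by simp [hμ]))
  rw [sahiE3_def, eXYZ, eXY, eXZ, eYZ, eX, eY, eZ]
  exact row36_cutVertexAY_ineq _ _ _ _ _ _ measureReal_nonneg hpa1 measureReal_nonneg c4 c2 g3 measureReal_nonneg hkb1
    measureReal_nonneg hkc1 k3

end Summit.CriticalPhenomena.PercolationContinuityZ3.Theorems.FrontierDecRows

end
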